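import Summits.ValiantsHypothesis.ValiantsHypothesis.Theorems.LacunarySymmetroidMatrixDescartesDoorA26WallBubblingMixThreeFrames
import Summits.ValiantsHypothesis.ValiantsHypothesis.Theorems.LacunarySymmetroidMatrixDescartesDoorA26WallBubblingClusterRungs

/-!
# Wall bubbling for `DoorA26` — THREE WEYL PAIRS: RUNGS IN CLUSTER CURRENCY (mixed classes, three clusters)

HONEST FRAMING.  Obligation (W) `stub_weylFaces` of `Cruxes/DoorA26/Lines/wall_bubbling.lean` (crux `DoorA26`, stmt-ValiantsHypothesis-19979; OPEN,
typed, never asserted); towards the (W_deepVal) chain hypothesis `ValueGenericThreePairChain26` (OPEN).  W1 seat val-sym-door-p2 g14 — step 4a of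
`HOME/val-sym-door-p2/g14/THREE-PAIR-CHAIN-PORT.md` (W1 #51 for three pairs): between clusters `c < c' (< c″)` of ONE sequence (centres `s c k`
drifting apart; Gram-normalised THREE-DSLOPE frames of the recentred letters, W1 #71 `threePairClusters_of_nondeg`), the frame-generic rules
(W1 #64–#69) instantiated for each class by RELABELLING letters/exponents with a permutation `σ` of `Fin 6` putting the class at positions
`(0,5)` (pure) / `(0,5),(1,4)` (mixed); frame equations = evaluation of the three-pair if-chain + `recenter_shift`.  This file: the repaired THREE-SCALE′ rungs of the mixed classes `δ₀+δ₁, δ₀+δ₂, δ₁+δ₂` (symmetric letters, `δ0 i ≠ δ0 j`).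

Registers unchanged; (W), `ValueGenericThreePairChain26`, `DoorA26` 19979, 18050 OPEN; nothing on VP ≠ VNP.  Def-free.
`--supports stmt-ValiantsHypothesis-19979 --as helper`.
-/

-- `Summit.ValiantsHypothesis.ValiantsHypothesis.…` repeats a component by the D-0017 layout
-- (single-conjunct summit), which the `dupNamespace` linter flags; the name is mandated.
set_option linter.dupNamespace false

namespace Summit.ValiantsHypothesis.ValiantsHypothesis.Theorems.LacunarySymmetroidMatrixDescartes.WallBubbling

open Finset Filter Topology
open Bubbling (polar)
open scoped BigOperators

/-- `threePair_clusters_mixThree₀₁`: mixed class at pairs (05),(14), three clusters of the three-pair frame — frame-generic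
`mixThree_frames` relabelled by `σ = ![0, 1, 2, 3, 4, 5]`. [this work] -/
theorem threePair_clusters_mixThree₀₁ (δs : ℕ → Fin 6 → ℝ) (δ0 : Fin 6 → ℝ)
    (hδ : ∀ l, Tendsto (fun k => δs k l) atTop (𝓝 (δ0 l))) (h50 : δ0 5 = δ0 0) (h41 : δ0 4 = δ0 1) (h01 : δ0 0 ≠ δ0 1)
    (U : ℕ → Fin 6 → Matrix (Fin 2) (Fin 2) ℝ) (hU : ∀ k l, (U k l).IsSymm) {C : ℕ} (s : Fin C → ℕ → ℝ)
    (μ : Fin C → ℕ → ℝ) (Γ : Fin C → Fin 6 → Fin 6 → ℝ) (hμ : ∀ c k, 0 < μ c k)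
    (hdom : ∀ c k, ∀ a b : Fin 6, |polar
      (if a = 0 then Real.exp (δs k 0 * s c k) • U k 0 + Real.exp (δs k 5 * s c k) • U k 5
        else if a = 1 then Real.exp (δs k 1 * s c k) • U k 1 + Real.exp (δs k 4 * s c k) • U k 4
        else if a = 2 then Real.exp (δs k 2 * s c k) • U k 2 + Real.exp (δs k 3 * s c k) • U k 3
        else if a = 3 then (δs k 3 - δs k 2) • (Real.exp (δs k 3 * s c k) • U k 3)
        else if a = 4 then (δs k 4 - δs k 1) • (Real.exp (δs k 4 * s c k) • U k 4) else (δs k 5 - δs k 0) • (Real.exp (δs k 5 * s c k) • U k 5))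
      (if b = 0 then Real.exp (δs k 0 * s c k) • U k 0 + Real.exp (δs k 5 * s c k) • U k 5
        else if b = 1 then Real.exp (δs k 1 * s c k) • U k 1 + Real.exp (δs k 4 * s c k) • U k 4
        else if b = 2 then Real.exp (δs k 2 * s c k) • U k 2 + Real.exp (δs k 3 * s c k) • U k 3
        else if b = 3 then (δs k 3 - δs k 2) • (Real.exp (δs k 3 * s c k) • U k 3)
        else if b = 4 then (δs k 4 - δs k 1) • (Real.exp (δs k 4 * s c k) • U k 4) else (δs k 5 - δs k 0) • (Real.exp (δs k 5 * s c k) • U k 5))| ≤ μ c k)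
    (hΓ : ∀ c, ∀ a b : Fin 6, Tendsto (fun k => polar
      (if a = 0 then Real.exp (δs k 0 * s c k) • U k 0 + Real.exp (δs k 5 * s c k) • U k 5
        else if a = 1 then Real.exp (δs k 1 * s c k) • U k 1 + Real.exp (δs k 4 * s c k) • U k 4
        else if a = 2 then Real.exp (δs k 2 * s c k) • U k 2 + Real.exp (δs k 3 * s c k) • U k 3
        else if a = 3 then (δs k 3 - δs k 2) • (Real.exp (δs k 3 * s c k) • U k 3)
        else if a = 4 then (δs k 4 - δs k 1) • (Real.exp (δs k 4 * s c k) • U k 4) else (δs k 5 - δs k 0) • (Real.exp (δs k 5 * s c k) • U k 5))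
      (if b = 0 then Real.exp (δs k 0 * s c k) • U k 0 + Real.exp (δs k 5 * s c k) • U k 5
        else if b = 1 then Real.exp (δs k 1 * s c k) • U k 1 + Real.exp (δs k 4 * s c k) • U k 4
        else if b = 2 then Real.exp (δs k 2 * s c k) • U k 2 + Real.exp (δs k 3 * s c k) • U k 3
        else if b = 3 then (δs k 3 - δs k 2) • (Real.exp (δs k 3 * s c k) • U k 3)
        else if b = 4 then (δs k 4 - δs k 1) • (Real.exp (δs k 4 * s c k) • U k 4) else (δs k 5 - δs k 0) • (Real.exp (δs k 5 * s c k) • U k 5)) / μ c k)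
      atTop (𝓝 (Γ c a b)))
    (c₁ c₂ c₃ : Fin C) (hL₁ : Tendsto (fun k => s c₂ k - s c₁ k) atTop atTop) (hL₂ : Tendsto (fun k => s c₃ k - s c₂ k) atTop atTop)
    (h1 : Γ c₁ 0 4 ≠ 0 ∨ Γ c₁ 5 1 ≠ 0) (h2 : Γ c₂ 0 4 ≠ 0 ∨ Γ c₂ 5 1 ≠ 0) (h3 : Γ c₃ 0 4 ≠ 0 ∨ Γ c₃ 5 1 ≠ 0) : False := by
  have hshift : ∀ k l, Real.exp (δs k l * (s c₂ k - s c₁ k)) • (Real.exp (δs k l * s c₁ k) • U k l)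
      = Real.exp (δs k l * s c₂ k) • U k l := fun k l => recenter_shift (δs k) (U k) (s c₁ k) (s c₂ k) l
  have hshift' : ∀ k l, Real.exp (δs k l * (s c₃ k - s c₁ k)) • (Real.exp (δs k l * s c₁ k) • U k l)
      = Real.exp (δs k l * s c₃ k) • U k l := fun k l => recenter_shift (δs k) (U k) (s c₁ k) (s c₃ k) l
  have f50 : ((5 : Fin 6) = 0) = False := by simp
  have f51 : ((5 : Fin 6) = 1) = False := by simp
  have f52 : ((5 : Fin 6) = 2) = False := by simp
  have f53 : ((5 : Fin 6) = 3) = False := by simp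
  have f54 : ((5 : Fin 6) = 4) = False := by simp
  have f10 : ((1 : Fin 6) = 0) = False := by simp
  have f40 : ((4 : Fin 6) = 0) = False := by simp
  have f41 : ((4 : Fin 6) = 1) = False := by simp
  have f42 : ((4 : Fin 6) = 2) = False := by simp
  have f43 : ((4 : Fin 6) = 3) = False := by simp
  have key := mixThree_frames (fun l => δ0 ((![0, 1, 2, 3, 4, 5] : Fin 6 → Fin 6) l)) (by simpa using h50) (by simpa using h41) (by simpa using h01) (fun k l => δs k ((![0, 1, 2, 3, 4, 5] : Fin 6 → Fin 6) l))
    (fun l => hδ _)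
    (fun k l => Real.exp (δs k ((![0, 1, 2, 3, 4, 5] : Fin 6 → Fin 6) l) * s c₁ k) • U k ((![0, 1, 2, 3, 4, 5] : Fin 6 → Fin 6) l))
    (fun k l => (hU k _).smul _)
    (fun k a => if ((![0, 1, 2, 3, 4, 5] : Fin 6 → Fin 6) a) = 0 then Real.exp (δs k 0 * s c₁ k) • U k 0 + Real.exp (δs k 5 * s c₁ k) • U k 5
        else if ((![0, 1, 2, 3, 4, 5] : Fin 6 → Fin 6) a) = 1 then Real.exp (δs k 1 * s c₁ k) • U k 1 + Real.exp (δs k 4 * s c₁ k) • U k 4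
        else if ((![0, 1, 2, 3, 4, 5] : Fin 6 → Fin 6) a) = 2 then Real.exp (δs k 2 * s c₁ k) • U k 2 + Real.exp (δs k 3 * s c₁ k) • U k 3
        else if ((![0, 1, 2, 3, 4, 5] : Fin 6 → Fin 6) a) = 3 then (δs k 3 - δs k 2) • (Real.exp (δs k 3 * s c₁ k) • U k 3)
        else if ((![0, 1, 2, 3, 4, 5] : Fin 6 → Fin 6) a) = 4 then (δs k 4 - δs k 1) • (Real.exp (δs k 4 * s c₁ k) • U k 4) else (δs k 5 - δs k 0) • (Real.exp (δs k 5 * s c₁ k) • U k 5))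
    (fun k a => if ((![0, 1, 2, 3, 4, 5] : Fin 6 → Fin 6) a) = 0 then Real.exp (δs k 0 * s c₂ k) • U k 0 + Real.exp (δs k 5 * s c₂ k) • U k 5
        else if ((![0, 1, 2, 3, 4, 5] : Fin 6 → Fin 6) a) = 1 then Real.exp (δs k 1 * s c₂ k) • U k 1 + Real.exp (δs k 4 * s c₂ k) • U k 4
        else if ((![0, 1, 2, 3, 4, 5] : Fin 6 → Fin 6) a) = 2 then Real.exp (δs k 2 * s c₂ k) • U k 2 + Real.exp (δs k 3 * s c₂ k) • U k 3
        else if ((![0, 1, 2, 3, 4, 5] : Fin 6 → Fin 6) a) = 3 then (δs k 3 - δs k 2) • (Real.exp (δs k 3 * s c₂ k) • U k 3)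
        else if ((![0, 1, 2, 3, 4, 5] : Fin 6 → Fin 6) a) = 4 then (δs k 4 - δs k 1) • (Real.exp (δs k 4 * s c₂ k) • U k 4) else (δs k 5 - δs k 0) • (Real.exp (δs k 5 * s c₂ k) • U k 5))
    (fun k a => if ((![0, 1, 2, 3, 4, 5] : Fin 6 → Fin 6) a) = 0 then Real.exp (δs k 0 * s c₃ k) • U k 0 + Real.exp (δs k 5 * s c₃ k) • U k 5
        else if ((![0, 1, 2, 3, 4, 5] : Fin 6 → Fin 6) a) = 1 then Real.exp (δs k 1 * s c₃ k) • U k 1 + Real.exp (δs k 4 * s c₃ k) • U k 4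
        else if ((![0, 1, 2, 3, 4, 5] : Fin 6 → Fin 6) a) = 2 then Real.exp (δs k 2 * s c₃ k) • U k 2 + Real.exp (δs k 3 * s c₃ k) • U k 3
        else if ((![0, 1, 2, 3, 4, 5] : Fin 6 → Fin 6) a) = 3 then (δs k 3 - δs k 2) • (Real.exp (δs k 3 * s c₃ k) • U k 3)
        else if ((![0, 1, 2, 3, 4, 5] : Fin 6 → Fin 6) a) = 4 then (δs k 4 - δs k 1) • (Real.exp (δs k 4 * s c₃ k) • U k 4) else (δs k 5 - δs k 0) • (Real.exp (δs k 5 * s c₃ k) • U k 5))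
    (fun k => s c₂ k - s c₁ k) (fun k => s c₃ k - s c₂ k) hL₁ hL₂
    (by intro k; simp)
    (by intro k; simp [f50, f51, f52, f53, f54])
    (by intro k; simp [f10])
    (by intro k; simp [f40, f41, f42, f43])
    (by intro k; simp [hshift])
    (by intro k; simp [f50, f51, f52, f53, f54, hshift])
    (by intro k; simp [f10, hshift])
    (by intro k; simp [f40, f41, f42, f43, hshift])
    (by intro k; simp [hshift'])
    (by intro k; simp [f50, f51, f52, f53, f54, hshift'])
    (by intro k; simp [f10, hshift'])
    (by intro k; simp [f40, f41, f42, f43, hshift'])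
    (μ c₁) (μ c₂) (μ c₃) (hμ c₁) (hμ c₂) (hμ c₃) (fun k a b => hdom c₁ k _ _) (fun k a b => hdom c₂ k _ _) (fun k a b => hdom c₃ k _ _)
    (fun a b => Γ c₁ ((![0, 1, 2, 3, 4, 5] : Fin 6 → Fin 6) a) ((![0, 1, 2, 3, 4, 5] : Fin 6 → Fin 6) b))
    (fun a b => Γ c₂ ((![0, 1, 2, 3, 4, 5] : Fin 6 → Fin 6) a) ((![0, 1, 2, 3, 4, 5] : Fin 6 → Fin 6) b))
    (fun a b => Γ c₃ ((![0, 1, 2, 3, 4, 5] : Fin 6 → Fin 6) a) ((![0, 1, 2, 3, 4, 5] : Fin 6 → Fin 6) b))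
    (fun a b => hΓ c₁ _ _) (fun a b => hΓ c₂ _ _) (fun a b => hΓ c₃ _ _) (by simpa using h1) (by simpa using h2) (by simpa using h3)
  exact key

/-- `threePair_clusters_mixThree₀₂`: mixed class at pairs (05),(23), three clusters of the three-pair frame — frame-generic
`mixThree_frames` relabelled by `σ = ![0, 2, 1, 4, 3, 5]`. [this work] -/
theorem threePair_clusters_mixThree₀₂ (δs : ℕ → Fin 6 → ℝ) (δ0 : Fin 6 → ℝ)
    (hδ : ∀ l, Tendsto (fun k => δs k l) atTop (𝓝 (δ0 l))) (h50 : δ0 5 = δ0 0) (h41 : δ0 3 = δ0 2) (h01 : δ0 0 ≠ δ0 2)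
    (U : ℕ → Fin 6 → Matrix (Fin 2) (Fin 2) ℝ) (hU : ∀ k l, (U k l).IsSymm) {C : ℕ} (s : Fin C → ℕ → ℝ)
    (μ : Fin C → ℕ → ℝ) (Γ : Fin C → Fin 6 → Fin 6 → ℝ) (hμ : ∀ c k, 0 < μ c k)
    (hdom : ∀ c k, ∀ a b : Fin 6, |polar
      (if a = 0 then Real.exp (δs k 0 * s c k) • U k 0 + Real.exp (δs k 5 * s c k) • U k 5
        else if a = 1 then Real.exp (δs k 1 * s c k) • U k 1 + Real.exp (δs k 4 * s c k) • U k 4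
        else if a = 2 then Real.exp (δs k 2 * s c k) • U k 2 + Real.exp (δs k 3 * s c k) • U k 3
        else if a = 3 then (δs k 3 - δs k 2) • (Real.exp (δs k 3 * s c k) • U k 3)
        else if a = 4 then (δs k 4 - δs k 1) • (Real.exp (δs k 4 * s c k) • U k 4) else (δs k 5 - δs k 0) • (Real.exp (δs k 5 * s c k) • U k 5))
      (if b = 0 then Real.exp (δs k 0 * s c k) • U k 0 + Real.exp (δs k 5 * s c k) • U k 5
        else if b = 1 then Real.exp (δs k 1 * s c k) • U k 1 + Real.exp (δs k 4 * s c k) • U k 4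
        else if b = 2 then Real.exp (δs k 2 * s c k) • U k 2 + Real.exp (δs k 3 * s c k) • U k 3
        else if b = 3 then (δs k 3 - δs k 2) • (Real.exp (δs k 3 * s c k) • U k 3)
        else if b = 4 then (δs k 4 - δs k 1) • (Real.exp (δs k 4 * s c k) • U k 4) else (δs k 5 - δs k 0) • (Real.exp (δs k 5 * s c k) • U k 5))| ≤ μ c k)
    (hΓ : ∀ c, ∀ a b : Fin 6, Tendsto (fun k => polar
      (if a = 0 then Real.exp (δs k 0 * s c k) • U k 0 + Real.exp (δs k 5 * s c k) • U k 5
        else if a = 1 then Real.exp (δs k 1 * s c k) • U k 1 + Real.exp (δs k 4 * s c k) • U k 4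
        else if a = 2 then Real.exp (δs k 2 * s c k) • U k 2 + Real.exp (δs k 3 * s c k) • U k 3
        else if a = 3 then (δs k 3 - δs k 2) • (Real.exp (δs k 3 * s c k) • U k 3)
        else if a = 4 then (δs k 4 - δs k 1) • (Real.exp (δs k 4 * s c k) • U k 4) else (δs k 5 - δs k 0) • (Real.exp (δs k 5 * s c k) • U k 5))
      (if b = 0 then Real.exp (δs k 0 * s c k) • U k 0 + Real.exp (δs k 5 * s c k) • U k 5
        else if b = 1 then Real.exp (δs k 1 * s c k) • U k 1 + Real.exp (δs k 4 * s c k) • U k 4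
        else if b = 2 then Real.exp (δs k 2 * s c k) • U k 2 + Real.exp (δs k 3 * s c k) • U k 3
        else if b = 3 then (δs k 3 - δs k 2) • (Real.exp (δs k 3 * s c k) • U k 3)
        else if b = 4 then (δs k 4 - δs k 1) • (Real.exp (δs k 4 * s c k) • U k 4) else (δs k 5 - δs k 0) • (Real.exp (δs k 5 * s c k) • U k 5)) / μ c k)
      atTop (𝓝 (Γ c a b)))
    (c₁ c₂ c₃ : Fin C) (hL₁ : Tendsto (fun k => s c₂ k - s c₁ k) atTop atTop) (hL₂ : Tendsto (fun k => s c₃ k - s c₂ k) atTop atTop)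
    (h1 : Γ c₁ 0 3 ≠ 0 ∨ Γ c₁ 5 2 ≠ 0) (h2 : Γ c₂ 0 3 ≠ 0 ∨ Γ c₂ 5 2 ≠ 0) (h3 : Γ c₃ 0 3 ≠ 0 ∨ Γ c₃ 5 2 ≠ 0) : False := by
  have hshift : ∀ k l, Real.exp (δs k l * (s c₂ k - s c₁ k)) • (Real.exp (δs k l * s c₁ k) • U k l)
      = Real.exp (δs k l * s c₂ k) • U k l := fun k l => recenter_shift (δs k) (U k) (s c₁ k) (s c₂ k) l
  have hshift' : ∀ k l, Real.exp (δs k l * (s c₃ k - s c₁ k)) • (Real.exp (δs k l * s c₁ k) • U k l)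
      = Real.exp (δs k l * s c₃ k) • U k l := fun k l => recenter_shift (δs k) (U k) (s c₁ k) (s c₃ k) l
  have f50 : ((5 : Fin 6) = 0) = False := by simp
  have f51 : ((5 : Fin 6) = 1) = False := by simp
  have f52 : ((5 : Fin 6) = 2) = False := by simp
  have f53 : ((5 : Fin 6) = 3) = False := by simp
  have f54 : ((5 : Fin 6) = 4) = False := by simp
  have f20 : ((2 : Fin 6) = 0) = False := by simp
  have f21 : ((2 : Fin 6) = 1) = False := by simp
  have f30 : ((3 : Fin 6) = 0) = False := by simp
  have f31 : ((3 : Fin 6) = 1) = False := by simp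
  have f32 : ((3 : Fin 6) = 2) = False := by simp
  have key := mixThree_frames (fun l => δ0 ((![0, 2, 1, 4, 3, 5] : Fin 6 → Fin 6) l)) (by simpa using h50) (by simpa using h41) (by simpa using h01) (fun k l => δs k ((![0, 2, 1, 4, 3, 5] : Fin 6 → Fin 6) l))
    (fun l => hδ _)
    (fun k l => Real.exp (δs k ((![0, 2, 1, 4, 3, 5] : Fin 6 → Fin 6) l) * s c₁ k) • U k ((![0, 2, 1, 4, 3, 5] : Fin 6 → Fin 6) l))
    (fun k l => (hU k _).smul _)
    (fun k a => if ((![0, 2, 1, 4, 3, 5] : Fin 6 → Fin 6) a) = 0 then Real.exp (δs k 0 * s c₁ k) • U k 0 + Real.exp (δs k 5 * s c₁ k) • U k 5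
        else if ((![0, 2, 1, 4, 3, 5] : Fin 6 → Fin 6) a) = 1 then Real.exp (δs k 1 * s c₁ k) • U k 1 + Real.exp (δs k 4 * s c₁ k) • U k 4
        else if ((![0, 2, 1, 4, 3, 5] : Fin 6 → Fin 6) a) = 2 then Real.exp (δs k 2 * s c₁ k) • U k 2 + Real.exp (δs k 3 * s c₁ k) • U k 3
        else if ((![0, 2, 1, 4, 3, 5] : Fin 6 → Fin 6) a) = 3 then (δs k 3 - δs k 2) • (Real.exp (δs k 3 * s c₁ k) • U k 3)
        else if ((![0, 2, 1, 4, 3, 5] : Fin 6 → Fin 6) a) = 4 then (δs k 4 - δs k 1) • (Real.exp (δs k 4 * s c₁ k) • U k 4) else (δs k 5 - δs k 0) • (Real.exp (δs k 5 * s c₁ k) • U k 5))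
    (fun k a => if ((![0, 2, 1, 4, 3, 5] : Fin 6 → Fin 6) a) = 0 then Real.exp (δs k 0 * s c₂ k) • U k 0 + Real.exp (δs k 5 * s c₂ k) • U k 5
        else if ((![0, 2, 1, 4, 3, 5] : Fin 6 → Fin 6) a) = 1 then Real.exp (δs k 1 * s c₂ k) • U k 1 + Real.exp (δs k 4 * s c₂ k) • U k 4
        else if ((![0, 2, 1, 4, 3, 5] : Fin 6 → Fin 6) a) = 2 then Real.exp (δs k 2 * s c₂ k) • U k 2 + Real.exp (δs k 3 * s c₂ k) • U k 3
        else if ((![0, 2, 1, 4, 3, 5] : Fin 6 → Fin 6) a) = 3 then (δs k 3 - δs k 2) • (Real.exp (δs k 3 * s c₂ k) • U k 3)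
        else if ((![0, 2, 1, 4, 3, 5] : Fin 6 → Fin 6) a) = 4 then (δs k 4 - δs k 1) • (Real.exp (δs k 4 * s c₂ k) • U k 4) else (δs k 5 - δs k 0) • (Real.exp (δs k 5 * s c₂ k) • U k 5))
    (fun k a => if ((![0, 2, 1, 4, 3, 5] : Fin 6 → Fin 6) a) = 0 then Real.exp (δs k 0 * s c₃ k) • U k 0 + Real.exp (δs k 5 * s c₃ k) • U k 5
        else if ((![0, 2, 1, 4, 3, 5] : Fin 6 → Fin 6) a) = 1 then Real.exp (δs k 1 * s c₃ k) • U k 1 + Real.exp (δs k 4 * s c₃ k) • U k 4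
        else if ((![0, 2, 1, 4, 3, 5] : Fin 6 → Fin 6) a) = 2 then Real.exp (δs k 2 * s c₃ k) • U k 2 + Real.exp (δs k 3 * s c₃ k) • U k 3
        else if ((![0, 2, 1, 4, 3, 5] : Fin 6 → Fin 6) a) = 3 then (δs k 3 - δs k 2) • (Real.exp (δs k 3 * s c₃ k) • U k 3)
        else if ((![0, 2, 1, 4, 3, 5] : Fin 6 → Fin 6) a) = 4 then (δs k 4 - δs k 1) • (Real.exp (δs k 4 * s c₃ k) • U k 4) else (δs k 5 - δs k 0) • (Real.exp (δs k 5 * s c₃ k) • U k 5))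
    (fun k => s c₂ k - s c₁ k) (fun k => s c₃ k - s c₂ k) hL₁ hL₂
    (by intro k; simp)
    (by intro k; simp [f50, f51, f52, f53, f54])
    (by intro k; simp [f20, f21])
    (by intro k; simp [f30, f31, f32])
    (by intro k; simp [hshift])
    (by intro k; simp [f50, f51, f52, f53, f54, hshift])
    (by intro k; simp [f20, f21, hshift])
    (by intro k; simp [f30, f31, f32, hshift])
    (by intro k; simp [hshift'])
    (by intro k; simp [f50, f51, f52, f53, f54, hshift'])
    (by intro k; simp [f20, f21, hshift'])
    (by intro k; simp [f30, f31, f32, hshift'])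
    (μ c₁) (μ c₂) (μ c₃) (hμ c₁) (hμ c₂) (hμ c₃) (fun k a b => hdom c₁ k _ _) (fun k a b => hdom c₂ k _ _) (fun k a b => hdom c₃ k _ _)
    (fun a b => Γ c₁ ((![0, 2, 1, 4, 3, 5] : Fin 6 → Fin 6) a) ((![0, 2, 1, 4, 3, 5] : Fin 6 → Fin 6) b))
    (fun a b => Γ c₂ ((![0, 2, 1, 4, 3, 5] : Fin 6 → Fin 6) a) ((![0, 2, 1, 4, 3, 5] : Fin 6 → Fin 6) b))
    (fun a b => Γ c₃ ((![0, 2, 1, 4, 3, 5] : Fin 6 → Fin 6) a) ((![0, 2, 1, 4, 3, 5] : Fin 6 → Fin 6) b))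
    (fun a b => hΓ c₁ _ _) (fun a b => hΓ c₂ _ _) (fun a b => hΓ c₃ _ _) (by simpa using h1) (by simpa using h2) (by simpa using h3)
  exact key

/-- `threePair_clusters_mixThree₁₂`: mixed class at pairs (14),(23), three clusters of the three-pair frame — frame-generic
`mixThree_frames` relabelled by `σ = ![1, 2, 0, 5, 3, 4]`. [this work] -/
theorem threePair_clusters_mixThree₁₂ (δs : ℕ → Fin 6 → ℝ) (δ0 : Fin 6 → ℝ)
    (hδ : ∀ l, Tendsto (fun k => δs k l) atTop (𝓝 (δ0 l))) (h50 : δ0 4 = δ0 1) (h41 : δ0 3 = δ0 2) (h01 : δ0 1 ≠ δ0 2)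
    (U : ℕ → Fin 6 → Matrix (Fin 2) (Fin 2) ℝ) (hU : ∀ k l, (U k l).IsSymm) {C : ℕ} (s : Fin C → ℕ → ℝ)
    (μ : Fin C → ℕ → ℝ) (Γ : Fin C → Fin 6 → Fin 6 → ℝ) (hμ : ∀ c k, 0 < μ c k)
    (hdom : ∀ c k, ∀ a b : Fin 6, |polar
      (if a = 0 then Real.exp (δs k 0 * s c k) • U k 0 + Real.exp (δs k 5 * s c k) • U k 5
        else if a = 1 then Real.exp (δs k 1 * s c k) • U k 1 + Real.exp (δs k 4 * s c k) • U k 4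
        else if a = 2 then Real.exp (δs k 2 * s c k) • U k 2 + Real.exp (δs k 3 * s c k) • U k 3
        else if a = 3 then (δs k 3 - δs k 2) • (Real.exp (δs k 3 * s c k) • U k 3)
        else if a = 4 then (δs k 4 - δs k 1) • (Real.exp (δs k 4 * s c k) • U k 4) else (δs k 5 - δs k 0) • (Real.exp (δs k 5 * s c k) • U k 5))
      (if b = 0 then Real.exp (δs k 0 * s c k) • U k 0 + Real.exp (δs k 5 * s c k) • U k 5
        else if b = 1 then Real.exp (δs k 1 * s c k) • U k 1 + Real.exp (δs k 4 * s c k) • U k 4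
        else if b = 2 then Real.exp (δs k 2 * s c k) • U k 2 + Real.exp (δs k 3 * s c k) • U k 3
        else if b = 3 then (δs k 3 - δs k 2) • (Real.exp (δs k 3 * s c k) • U k 3)
        else if b = 4 then (δs k 4 - δs k 1) • (Real.exp (δs k 4 * s c k) • U k 4) else (δs k 5 - δs k 0) • (Real.exp (δs k 5 * s c k) • U k 5))| ≤ μ c k)
    (hΓ : ∀ c, ∀ a b : Fin 6, Tendsto (fun k => polar
      (if a = 0 then Real.exp (δs k 0 * s c k) • U k 0 + Real.exp (δs k 5 * s c k) • U k 5
        else if a = 1 then Real.exp (δs k 1 * s c k) • U k 1 + Real.exp (δs k 4 * s c k) • U k 4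
        else if a = 2 then Real.exp (δs k 2 * s c k) • U k 2 + Real.exp (δs k 3 * s c k) • U k 3
        else if a = 3 then (δs k 3 - δs k 2) • (Real.exp (δs k 3 * s c k) • U k 3)
        else if a = 4 then (δs k 4 - δs k 1) • (Real.exp (δs k 4 * s c k) • U k 4) else (δs k 5 - δs k 0) • (Real.exp (δs k 5 * s c k) • U k 5))
      (if b = 0 then Real.exp (δs k 0 * s c k) • U k 0 + Real.exp (δs k 5 * s c k) • U k 5
        else if b = 1 then Real.exp (δs k 1 * s c k) • U k 1 + Real.exp (δs k 4 * s c k) • U k 4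
        else if b = 2 then Real.exp (δs k 2 * s c k) • U k 2 + Real.exp (δs k 3 * s c k) • U k 3
        else if b = 3 then (δs k 3 - δs k 2) • (Real.exp (δs k 3 * s c k) • U k 3)
        else if b = 4 then (δs k 4 - δs k 1) • (Real.exp (δs k 4 * s c k) • U k 4) else (δs k 5 - δs k 0) • (Real.exp (δs k 5 * s c k) • U k 5)) / μ c k)
      atTop (𝓝 (Γ c a b)))
    (c₁ c₂ c₃ : Fin C) (hL₁ : Tendsto (fun k => s c₂ k - s c₁ k) atTop atTop) (hL₂ : Tendsto (fun k => s c₃ k - s c₂ k) atTop atTop)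
    (h1 : Γ c₁ 1 3 ≠ 0 ∨ Γ c₁ 4 2 ≠ 0) (h2 : Γ c₂ 1 3 ≠ 0 ∨ Γ c₂ 4 2 ≠ 0) (h3 : Γ c₃ 1 3 ≠ 0 ∨ Γ c₃ 4 2 ≠ 0) : False := by
  have hshift : ∀ k l, Real.exp (δs k l * (s c₂ k - s c₁ k)) • (Real.exp (δs k l * s c₁ k) • U k l)
      = Real.exp (δs k l * s c₂ k) • U k l := fun k l => recenter_shift (δs k) (U k) (s c₁ k) (s c₂ k) l
  have hshift' : ∀ k l, Real.exp (δs k l * (s c₃ k - s c₁ k)) • (Real.exp (δs k l * s c₁ k) • U k l)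
      = Real.exp (δs k l * s c₃ k) • U k l := fun k l => recenter_shift (δs k) (U k) (s c₁ k) (s c₃ k) l
  have f10 : ((1 : Fin 6) = 0) = False := by simp
  have f40 : ((4 : Fin 6) = 0) = False := by simp
  have f41 : ((4 : Fin 6) = 1) = False := by simp
  have f42 : ((4 : Fin 6) = 2) = False := by simp
  have f43 : ((4 : Fin 6) = 3) = False := by simp
  have f20 : ((2 : Fin 6) = 0) = False := by simp
  have f21 : ((2 : Fin 6) = 1) = False := by simp
  have f30 : ((3 : Fin 6) = 0) = False := by simp
  have f31 : ((3 : Fin 6) = 1) = False := by simp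
  have f32 : ((3 : Fin 6) = 2) = False := by simp
  have key := mixThree_frames (fun l => δ0 ((![1, 2, 0, 5, 3, 4] : Fin 6 → Fin 6) l)) (by simpa using h50) (by simpa using h41) (by simpa using h01) (fun k l => δs k ((![1, 2, 0, 5, 3, 4] : Fin 6 → Fin 6) l))
    (fun l => hδ _)
    (fun k l => Real.exp (δs k ((![1, 2, 0, 5, 3, 4] : Fin 6 → Fin 6) l) * s c₁ k) • U k ((![1, 2, 0, 5, 3, 4] : Fin 6 → Fin 6) l))
    (fun k l => (hU k _).smul _)
    (fun k a => if ((![1, 2, 0, 5, 3, 4] : Fin 6 → Fin 6) a) = 0 then Real.exp (δs k 0 * s c₁ k) • U k 0 + Real.exp (δs k 5 * s c₁ k) • U k 5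
        else if ((![1, 2, 0, 5, 3, 4] : Fin 6 → Fin 6) a) = 1 then Real.exp (δs k 1 * s c₁ k) • U k 1 + Real.exp (δs k 4 * s c₁ k) • U k 4
        else if ((![1, 2, 0, 5, 3, 4] : Fin 6 → Fin 6) a) = 2 then Real.exp (δs k 2 * s c₁ k) • U k 2 + Real.exp (δs k 3 * s c₁ k) • U k 3
        else if ((![1, 2, 0, 5, 3, 4] : Fin 6 → Fin 6) a) = 3 then (δs k 3 - δs k 2) • (Real.exp (δs k 3 * s c₁ k) • U k 3)
        else if ((![1, 2, 0, 5, 3, 4] : Fin 6 → Fin 6) a) = 4 then (δs k 4 - δs k 1) • (Real.exp (δs k 4 * s c₁ k) • U k 4) else (δs k 5 - δs k 0) • (Real.exp (δs k 5 * s c₁ k) • U k 5))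
    (fun k a => if ((![1, 2, 0, 5, 3, 4] : Fin 6 → Fin 6) a) = 0 then Real.exp (δs k 0 * s c₂ k) • U k 0 + Real.exp (δs k 5 * s c₂ k) • U k 5
        else if ((![1, 2, 0, 5, 3, 4] : Fin 6 → Fin 6) a) = 1 then Real.exp (δs k 1 * s c₂ k) • U k 1 + Real.exp (δs k 4 * s c₂ k) • U k 4
        else if ((![1, 2, 0, 5, 3, 4] : Fin 6 → Fin 6) a) = 2 then Real.exp (δs k 2 * s c₂ k) • U k 2 + Real.exp (δs k 3 * s c₂ k) • U k 3
        else if ((![1, 2, 0, 5, 3, 4] : Fin 6 → Fin 6) a) = 3 then (δs k 3 - δs k 2) • (Real.exp (δs k 3 * s c₂ k) • U k 3)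
        else if ((![1, 2, 0, 5, 3, 4] : Fin 6 → Fin 6) a) = 4 then (δs k 4 - δs k 1) • (Real.exp (δs k 4 * s c₂ k) • U k 4) else (δs k 5 - δs k 0) • (Real.exp (δs k 5 * s c₂ k) • U k 5))
    (fun k a => if ((![1, 2, 0, 5, 3, 4] : Fin 6 → Fin 6) a) = 0 then Real.exp (δs k 0 * s c₃ k) • U k 0 + Real.exp (δs k 5 * s c₃ k) • U k 5
        else if ((![1, 2, 0, 5, 3, 4] : Fin 6 → Fin 6) a) = 1 then Real.exp (δs k 1 * s c₃ k) • U k 1 + Real.exp (δs k 4 * s c₃ k) • U k 4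
        else if ((![1, 2, 0, 5, 3, 4] : Fin 6 → Fin 6) a) = 2 then Real.exp (δs k 2 * s c₃ k) • U k 2 + Real.exp (δs k 3 * s c₃ k) • U k 3
        else if ((![1, 2, 0, 5, 3, 4] : Fin 6 → Fin 6) a) = 3 then (δs k 3 - δs k 2) • (Real.exp (δs k 3 * s c₃ k) • U k 3)
        else if ((![1, 2, 0, 5, 3, 4] : Fin 6 → Fin 6) a) = 4 then (δs k 4 - δs k 1) • (Real.exp (δs k 4 * s c₃ k) • U k 4) else (δs k 5 - δs k 0) • (Real.exp (δs k 5 * s c₃ k) • U k 5))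
    (fun k => s c₂ k - s c₁ k) (fun k => s c₃ k - s c₂ k) hL₁ hL₂
    (by intro k; simp [f10])
    (by intro k; simp [f40, f41, f42, f43])
    (by intro k; simp [f20, f21])
    (by intro k; simp [f30, f31, f32])
    (by intro k; simp [f10, hshift])
    (by intro k; simp [f40, f41, f42, f43, hshift])
    (by intro k; simp [f20, f21, hshift])
    (by intro k; simp [f30, f31, f32, hshift])
    (by intro k; simp [f10, hshift'])
    (by intro k; simp [f40, f41, f42, f43, hshift'])
    (by intro k; simp [f20, f21, hshift'])
    (by intro k; simp [f30, f31, f32, hshift'])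
    (μ c₁) (μ c₂) (μ c₃) (hμ c₁) (hμ c₂) (hμ c₃) (fun k a b => hdom c₁ k _ _) (fun k a b => hdom c₂ k _ _) (fun k a b => hdom c₃ k _ _)
    (fun a b => Γ c₁ ((![1, 2, 0, 5, 3, 4] : Fin 6 → Fin 6) a) ((![1, 2, 0, 5, 3, 4] : Fin 6 → Fin 6) b))
    (fun a b => Γ c₂ ((![1, 2, 0, 5, 3, 4] : Fin 6 → Fin 6) a) ((![1, 2, 0, 5, 3, 4] : Fin 6 → Fin 6) b))
    (fun a b => Γ c₃ ((![1, 2, 0, 5, 3, 4] : Fin 6 → Fin 6) a) ((![1, 2, 0, 5, 3, 4] : Fin 6 → Fin 6) b))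
    (fun a b => hΓ c₁ _ _) (fun a b => hΓ c₂ _ _) (fun a b => hΓ c₃ _ _) (by simpa using h1) (by simpa using h2) (by simpa using h3)
  exact key

end Summit.ValiantsHypothesis.ValiantsHypothesis.Theorems.LacunarySymmetroidMatrixDescartes.WallBubbling
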